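import Mathlib
import Summits.AtomisticToContinuum.Crystallization.Theorems.ThreeConeCertificateExactCertificateTransfer1DPositional

/-!
# Crux `ExactCertificate` (stmt-AtomisticToContinuum-11959), line `closure-makes-nogap-exact`,
# Transfer skeleton IV `SlackRigidity1D` — stub `stub_sqSumOfSlack`: convexity with slack

Support file (`--supports stmt-AtomisticToContinuum-11959`) for the crux `ThreeConeCertificate.ExactCertificate`,
line `closure-makes-nogap-exact`, Transfer skeleton IV `SlackRigidity1D` (slack rigidity of the Lennard-Jones CHAIN:
the route decl `SlackRigidity` with `3 ↦ 1`, verbatim otherwise); nothing here closes the 3-D crux.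

Step 3 of the skeleton (CONVEXITY WITH SLACK): a strictly increasing configuration `z` of `n` reals whose
nearest-neighbour gaps lie in the box `[3/4, 1]` and whose line energy `L(z) = ∑_{i<j<n} V(|z j − z i|)`,
`V = lennardJones`, is `≤ n·e_a + s`, where `n·e_a` bounds from below the line energy of EVERY strictly increasing
configuration of `n` reals and the `n`-chain of spacing `a ∈ [3/4, 1]` has line energy `≤ n·e_a + C`, satisfies
`Σ_{i<n−1} (a − (z (i+1) − z i))² ≤ 2(s + C)`.

Mechanism (the tree's `pos1d_sq_sum_le`, with the lower bound applied to the midpoint configuration in place of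
minimality).  Let `c i := z 0 + i a` be the perfect chain through `z 0` and `m := (z + c)/2` the midpoint
configuration; `m` is strictly increasing, so `n·e_a ≤ L(m)`.  Uniform midpoint convexity of the line energy in gap
coordinates on the box (`stub_lineEnergyConvex` fed with `stub_ljMidpointConvex`) gives
`L(m) ≤ (L(z) + L(c))/2 − ¼ Σ_i (a − gap_i)²`, and `L(c) = Σ_{d<n} (n − d) V(da) ≤ n·e_a + C`
(`pos1d_chain_lineEnergy`), whence `¼ Σ ≤ (n e_a + s + n e_a + C)/2 − n e_a = (s + C)/2`.  All `[folklore]`.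
-/

noncomputable section

namespace Summit.AtomisticToContinuum.Crystallization.Theorems.ThreeConeCertificateExactCertificate.Transfer1D

open Literature.MathematicalPhysics.StatisticalMechanics
open scoped BigOperators

/-- **Registered stub `stub_sqSumOfSlack`** — CONVEXITY WITH SLACK (the tree's `pos1d_sq_sum_le` with the lower
bound `n·e_a` for the midpoint configuration in place of minimality): a strictly increasing configuration `z` of
`n` reals in the box `[3/4, 1]` with line energy `≤ n·e_a + s`, where `n·e_a` is a lower bound for the line energy
of EVERY strictly increasing configuration of `n` reals and the `n`-chain of spacing `a` has line energy
`≤ n·e_a + C`, satisfies `Σ_{i<n−1} (a − gap_i)² ≤ 2(s + C)`. [folklore] -/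
theorem stub_sqSumOfSlack : ∀ (a eA C s : ℝ), 3 / 4 ≤ a → a ≤ 1 →
    (∀ N : ℕ, ∑ d ∈ Finset.range N, ((N : ℝ) - d) * lennardJones (d * a) ≤ N * eA + C) →
    ∀ (n : ℕ) (z : ℕ → ℝ), (∀ i j : ℕ, i < j → j < n → z i < z j) →
      (∀ i : ℕ, i + 1 < n → 3 / 4 ≤ z (i + 1) - z i ∧ z (i + 1) - z i ≤ 1) →
      (∀ y' : ℕ → ℝ, (∀ i j : ℕ, i < j → j < n → y' i < y' j) →
        (n : ℝ) * eA ≤ ∑ i ∈ Finset.range n, ∑ j ∈ Finset.Ico (i + 1) n, lennardJones (|y' j - y' i|)) →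
      ∑ i ∈ Finset.range n, ∑ j ∈ Finset.Ico (i + 1) n, lennardJones (|z j - z i|) ≤ n * eA + s →
      ∑ i ∈ Finset.range (n - 1), (a - (z (i + 1) - z i)) ^ 2 ≤ 2 * (s + C) := by
  intro a eA C s ha34 ha1 hC n z hz hbox hkep hslack
  -- the perfect chain through `z 0`
  set c : ℕ → ℝ := fun i => z 0 + i * a with hc
  have hcgap : ∀ i : ℕ, c (i + 1) - c i = a := fun i => by simp only [hc]; push_cast; ring
  have hcbox : ∀ i : ℕ, i + 1 < n → 3 / 4 ≤ c (i + 1) - c i ∧ c (i + 1) - c i ≤ 1 :=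
    fun i _ => by rw [hcgap]; exact ⟨ha34, ha1⟩
  have hD := stub_lineEnergyConvex lennardJones stub_ljMidpointConvex.1 stub_ljMidpointConvex.2 n z c hbox hcbox
  -- the midpoint configuration is strictly increasing, hence the lower bound `n e_a` applies to it
  have hcmono : ∀ i j : ℕ, i < j → j < n → c i < c j := fun i j hij _ => by
    simp only [hc]
    have : (i : ℝ) < j := by exact_mod_cast hij
    nlinarith
  have hm : ∀ i j : ℕ, i < j → j < n → (z i + c i) / 2 < (z j + c j) / 2 :=
    fun i j hij hjn => by linarith [hz i j hij hjn, hcmono i j hij hjn]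
  have hmid := hkep (fun i => (z i + c i) / 2) hm
  rw [pos1d_sum_abs_eq lennardJones n (fun i => (z i + c i) / 2) hm] at hmid
  rw [pos1d_sum_abs_eq _ _ _ hz] at hslack
  -- the chain's line energy is within `C` of `n e_a`
  have hchain : ∑ i ∈ Finset.range n, ∑ j ∈ Finset.Ico (i + 1) n, lennardJones (c j - c i) ≤ n * eA + C := by
    have h := pos1d_chain_lineEnergy a (z 0) n
    simp only [hc]
    rw [h]
    exact hC n
  -- the defect sum of `stub_lineEnergyConvex` is `Σ (a − gap)²`
  have hS : ∑ i ∈ Finset.range (n - 1), ((c (i + 1) - c i) - (z (i + 1) - z i)) ^ 2 =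
      ∑ i ∈ Finset.range (n - 1), (a - (z (i + 1) - z i)) ^ 2 :=
    Finset.sum_congr rfl fun i _ => by rw [hcgap]
  rw [hS] at hD
  linarith

end Summit.AtomisticToContinuum.Crystallization.Theorems.ThreeConeCertificateExactCertificate.Transfer1D

end
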